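import Literature.AlgebraicGeometry.AbelianSchemes.SerreTensorRecognition
import Literature.AlgebraicGeometry.AbelianSchemes.AbelianSchemeFixedPowBaseChange
import Literature.AlgebraicGeometry.AbelianSchemes.AbelianSchemeOverCommOfReduced
import Literature.AlgebraicGeometry.Motives.AbelianVarietyRelFrobeniusDegree
import HarnessLib

/-!
# (ST-2F) The Frobenius twist `A^{(q)}` is a Serre tensor `A ⊗_𝒪 𝔟` — recognition along the relative Frobenius

Topic `Literature/AlgebraicGeometry/AbelianSchemes`, namespace `Literature.AlgebraicGeometry.AbelianSchemes.AbelianSchemeOver`; TWO plumbing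
definitions (`relFrobeniusHom`, the relative Frobenius typed on the abelian `k`-schemes, and `RingAction.frobeniusTwist`, the base-changed `𝒪`-action on
`A^{(q)}` — the `RingAction` twin of ★ (DF-1) `DualPair.frobeniusTwist`) and THEOREMS (no named
fact, no `sorry`, no `instance`, no notation).  Cell `hodgecm-mathlib`, F0/P6 «MOD», the first organ of the σ2 = (β′) spine of `stub_HFROB` (LEAD M-16b (3): «block
computation via SERRE-TENSOR recognition of `A^{(q)}` (ST-2∕ST-4∕FROB-PIC∕(DF))»); `--supports stmt-HodgeConjecture-24832`, count-neutral.  HC_CM is proved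
only modulo the 2 remaining named inputs (hLiu418, h413) until rung 0 closes; this file discharges none of them.

## Mathematics

`k` a field of exponential characteristic `p`, `q = pⁿ`, `A` an abelian variety over `k` with an action `ι : 𝒪 → End A` (on the abelian `k`-scheme
`A₀ := (ofAbelianVariety A).toOver`), `F = F_{A/k,q} : A → A^{(q)}` the relative Frobenius (★ `AbelianVariety.relFrobenius`), `A^{(q)} = A₀ ×_{k,Frobⁿ} k`
(definitionally, ★ `toOver_ofAbelianVariety_frobeniusTwist`) with the base-changed action `ι^{(q)}` (§0).  §1: `F` is a finite flat surjective homomorphism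
(★ `isIsogeny_relFrobenius`, ★ `IsIsogeny.flat_toSchemeHom_holds`) of constant rank `q^{dim A}` over a perfect field (★ `kerRank_relFrobenius`,
★ `IsIsogeny.finrank_eq_kerRank`), and `𝒪`-EQUIVARIANT: `ι(a) ≫ F = F ≫ ι^{(q)}(a)` (naturality ★ `relFrobeniusOver_comp_map`).  Let `ψ_P : A → A ⊗_𝒪 𝔟`
be the ★ Serre translate of an ideal `𝔭 = (P₁,…,P_m)` (★ `SerreTensorIdealTranslationKernel`: `E′` idempotent presenting `𝔟`, `E′P = P`, quasi-inverse row
`Q` up to `N ≠ 0`), an `𝒪`-equivariant finite flat surjective homomorphism killing exactly `A[𝔭]`.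
§2 (R1) If `A[𝔭] ⊆ Ker F` on points and `ψ_P`, `F` have the same constant rank, ★ ST-2 (`exists_iso_serreTranslate_comp_eq_of_forall_comp_eq_one`)
gives a unique `e : A ⊗_𝒪 𝔟 ≅ A^{(q)}` with `ψ_P ≫ e = F`, a homomorphism, `𝒪`-equivariant; then `Ker F = A[𝔭]` exactly.
§3 (R2) If instead `Ker F ⊆ A[𝔭]` on points (the direction produced by the tangent-space ∕ Lie-algebra criterion of the E2 road, cf. ★
`exists_iso_of_relFrobenius_comp_eq`) and the ranks agree, ★ ST-2b (`exists_iso_comp_eq_equivariant_of_forall_comp_eq_one`, roles swapped: descent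
along the fppf cover `F`) gives a unique `e : A^{(q)} ≅ A ⊗_𝒪 𝔟` with `F ≫ e = ψ_P`, again an `𝒪`-equivariant homomorphism, and `Ker F = A[𝔭]`.
The two hypotheses left to the consumer are the kernel inclusion (FROB₀ ∕ the block computation) and the rank of `A[𝔭]` (`= q^{dim A}`).

## Contents

* §0 `relFrobeniusHom p n A : A₀.X ⟶ A^{(q)}.X` (the relative Frobenius typed on the abelian `k`-schemes; `= (A.relFrobenius p n).hom.hom.hom`, `rfl`),
  `RingAction.frobeniusTwist` (`ι^{(q)}(a) := ι(a) ×_k Frobⁿ`), `RingAction.frobeniusTwist_i`, `isCommMonObj_toOver_ofAbelianVariety`.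
* §1 `isMonHom_relFrobeniusHom`, `isFinite_relFrobeniusHom_left`, `flat_relFrobeniusHom_left`, `surjective_relFrobeniusHom_left`, `finrank_relFrobeniusHom_left`
  (`= p^(n·dim A)`, `k` perfect), **`RingAction.i_comp_relFrobeniusHom`** (`ι(a) ≫ F = F ≫ ι^{(q)}(a)`).
* §2 **`exists_iso_serreTranslate_comp_eq_relFrobenius`** (R1), `exists_iso_serreTranslate_comp_eq_relFrobenius_of_perfectField`,
  `comp_relFrobenius_eq_one_iff_forall_mem_of_serreTranslate_comp_eq` (`Ker F = A[𝔭]`).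
* §3 **`exists_iso_relFrobenius_comp_eq_serreTranslate`** (R2), `exists_iso_relFrobenius_comp_eq_serreTranslate_of_perfectField`,
  `comp_relFrobenius_eq_one_iff_forall_mem_of_relFrobenius_comp_eq`.

## References
* [Shimura1998] G. Shimura, *Abelian Varieties with Complex Multiplication and Modular Functions* (1998), §13.1 proof of Thm. 1 (pp. 97–99)
  («`ν(λ̃) = N𝔮 = qⁿ` ⇒ the factor of `λ̃` through the Frobenius is an isomorphism»).
* [MilneCM2006] J. S. Milne, *Complex Multiplication* (2006), §7 (Def. 7.19, Prop. 7.22, Rem. 7.23; `A → A ⊗ 𝔞⁻¹ = A⁄A[𝔞]`), §8 (Shimura–Taniyama formula).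
* [MumfordAV1970] D. Mumford, *Abelian Varieties* (1970), §7 Thm. 4 (p. 72), §15 (p. 146).
* [Conrad2004GrossZagier] B. Conrad, *Gross–Zagier revisited* (2004), §7 (Serre tensor construction, Thm. 7.5).
* [RapoportSmithlingZhang2020Diagonal] M. Rapoport, B. Smithling, W. Zhang (2020), §4 (p. 20), (4.23).
* Tree: ★ `SerreTensorRecognition` (ST-2), ★ `AbelianSchemeHomDescentEquivariant` (ST-2b), ★ `SerreTensorIdealTranslationKernel` (A),
  ★ `AbelianVarietyRelFrobeniusDegree`, ★ `AbelianVarietyFrobeniusTwistVariety`, ★ `AbelianSchemeFixedPowBaseChange` (`RingAction.baseChange`).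
-/

noncomputable section

universe u

open CategoryTheory CategoryTheory.Limits AlgebraicGeometry MonoidalCategory CartesianMonoidalCategory
open scoped MonObj

namespace Literature.AlgebraicGeometry.AbelianSchemes

namespace AbelianSchemeOver

open Literature.AlgebraicGeometry.Motives Literature.AlgebraicGeometry.Motives.AbelianVariety

variable {k : Type u} [Field k] (p : ℕ) [ExpChar k p] (n : ℕ) (A : AbelianVariety k) {O : Type*} [CommRing O]

/-! ## §0 The `𝒪`-action on the Frobenius twist -/

/-- The abelian `k`-scheme `A₀ = (ofAbelianVariety A).toOver` of an abelian variety is a commutative group scheme (★ `isCommMonObj_of_field`; stated for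
`haveI` by the consumers of the Serre tensor construction). [cite: MumfordAV1970, §4 (ii) (p. 41)] -/
theorem isCommMonObj_toOver_ofAbelianVariety : IsCommMonObj (AbelianScheme.ofAbelianVariety A).toOver.X :=
  isCommMonObj_of_field _

/-- **The relative Frobenius `F_{A/k,q} : A → A^{(q)}` as a morphism of the abelian `k`-schemes** `A₀ = (ofAbelianVariety A).toOver` and
`(ofAbelianVariety A^{(q)}).toOver = A₀ ×_{k,Frobⁿ} k` (a typed copy of ★ `(A.relFrobenius p n).hom.hom.hom = relFrobeniusOver p n A.X`, so that the Serre-tensor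
apparatus over the base `Spec k` applies verbatim). [cite: MumfordAV1970, §15 (p. 146)] -/
def relFrobeniusHom :
    (AbelianScheme.ofAbelianVariety A).toOver.X ⟶ (AbelianScheme.ofAbelianVariety (A.frobeniusTwist p n)).toOver.X :=
  (A.relFrobenius p n).hom.hom.hom

/-- `relFrobeniusHom p n A` is the homomorphism underlying ★ `A.relFrobenius p n` (definitional). [cite: MumfordAV1970, §15 (p. 146)] -/
theorem relFrobeniusHom_eq : relFrobeniusHom p n A = (A.relFrobenius p n).hom.hom.hom :=
  rfl

/-- `relFrobeniusHom p n A` is ★ `relFrobeniusOver p n A.X` (definitional). [cite: MumfordAV1970, §15 (p. 146)] -/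
theorem relFrobeniusHom_eq_relFrobeniusOver : relFrobeniusHom p n A = relFrobeniusOver p n A.X :=
  rfl

/-- Its scheme map is ★ `Hom.toSchemeHom (A.relFrobenius p n)` (definitional). [cite: MumfordAV1970, §15 (p. 146)] -/
theorem relFrobeniusHom_left : (relFrobeniusHom p n A).left = Hom.toSchemeHom (A.relFrobenius p n) :=
  rfl

/-- `F_{A/k,q}` is a homomorphism of group schemes. [cite: MumfordAV1970, §15 (p. 146)] -/
theorem isMonHom_relFrobeniusHom : IsMonHom (relFrobeniusHom p n A) :=
  inferInstanceAs (IsMonHom (A.relFrobenius p n).hom.hom.hom)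

variable {A} (act : (AbelianScheme.ofAbelianVariety A).toOver.RingAction O)

/-- **The `𝒪`-action `ι^{(q)}` on the Frobenius twist `A^{(q)} = A ×_{k,Frobⁿ} k`**: the base change of `ι` along `Spec Frobⁿ` (★ `RingAction.baseChange`;
`A^{(q)}` IS that base change, ★ `toOver_ofAbelianVariety_frobeniusTwist`). [cite: Shimura1998, §13.1 proof of Thm. 1 (pp. 97–99)]
[cite: Kottwitz1992, §5 (p. 390)] -/
def RingAction.frobeniusTwist : (AbelianScheme.ofAbelianVariety (A.frobeniusTwist p n)).toOver.RingAction O :=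
  act.baseChange (frobSpec k p n)

/-- `ι^{(q)}(a) = ι(a) ×_k Frobⁿ` (definitional). [cite: Kottwitz1992, §5 (p. 390)] -/
theorem RingAction.frobeniusTwist_i (a : O) :
    (act.frobeniusTwist p n).i a = (Over.pullback (frobSpec k p n)).map (act.i a) :=
  rfl

/-- `act.frobeniusTwist p n` is `act.baseChange (Spec Frobⁿ)` (definitional). [cite: Kottwitz1992, §5 (p. 390)] -/
theorem RingAction.frobeniusTwist_eq_baseChange : act.frobeniusTwist p n = act.baseChange (frobSpec k p n) :=
  rfl

/-! ## §1 The relative Frobenius as an `𝒪`-equivariant finite flat surjective homomorphism of abelian `k`-schemes -/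

variable (A)

/-- `F_{A/k,q}` is FINITE (★ `isIsogeny_relFrobenius`). [cite: MumfordAV1970, §15 (p. 146)] -/
theorem isFinite_relFrobeniusHom_left : IsFinite (relFrobeniusHom p n A).left :=
  (A.isIsogeny_relFrobenius p n).2

/-- `F_{A/k,q}` is SURJECTIVE (★ `isIsogeny_relFrobenius`). [cite: MumfordAV1970, §15 (p. 146)] -/
theorem surjective_relFrobeniusHom_left : Surjective (relFrobeniusHom p n A).left :=
  (A.isIsogeny_relFrobenius p n).1

/-- `F_{A/k,q}` is FLAT (isogenies are flat, ★ `IsIsogeny.flat_toSchemeHom_holds`). [cite: GortzWedhorn2023, Cor. 27.177 (1)] -/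
theorem flat_relFrobeniusHom_left : Flat (relFrobeniusHom p n A).left :=
  IsIsogeny.flat_toSchemeHom_holds (A.isIsogeny_relFrobenius p n)

/-- **`F_{A/k,q}` has constant rank `q^{dim A}`** over a perfect field (★ `kerRank_relFrobenius`, ★ `IsIsogeny.finrank_eq_kerRank`).
[cite: MumfordAV1970, §15 (p. 146)] -/
theorem finrank_relFrobeniusHom_left [PerfectField k] (b : (AbelianScheme.ofAbelianVariety (A.frobeniusTwist p n)).toOver.left) :
    (relFrobeniusHom p n A).left.finrank b = p ^ (n * A.dim) := by
  rw [← A.kerRank_relFrobenius p n]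
  exact (A.isIsogeny_relFrobenius p n).finrank_eq_kerRank b

variable {A}

/-- **`F_{A/k,q}` is `𝒪`-equivariant: `ι(a) ≫ F = F ≫ ι^{(q)}(a)`** (naturality of the relative Frobenius, ★ `relFrobeniusOver_comp_map`).
[cite: Shimura1998, §13.1 proof of Thm. 1 (pp. 97–99)] [cite: Milne2025, VI §13 Rem. 13.5 (p. 302)] -/
theorem RingAction.i_comp_relFrobeniusHom (a : O) :
    act.i a ≫ relFrobeniusHom p n A = relFrobeniusHom p n A ≫ (act.frobeniusTwist p n).i a := by
  change act.i a ≫ relFrobeniusOver p n _ = relFrobeniusOver p n _ ≫ (Over.pullback (frobSpec k p n)).map (act.i a)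
  exact (relFrobeniusOver_comp_map p n (act.i a)).symm

/-! ## §2 (R1) `A[𝔭] ⊆ Ker F` and equal ranks ⇒ `A ⊗_𝒪 𝔟 ≅ A^{(q)}` under `A`, `ψ_P ↦ F` -/

variable [IsCommMonObj (AbelianScheme.ofAbelianVariety A).toOver.X]
  {m : ℕ} (E' : Matrix (Fin m) (Fin m) O) (hE' : E' * E' = E') (P : Matrix (Fin m) (Fin 1) O) (Q : Matrix (Fin 1) (Fin m) O) {N : ℕ}

/-- **(R1) THE FROBENIUS TWIST IS THE SERRE TENSOR, `ψ_P ↦ F`.**  If `A[𝔭] ⊆ Ker F_{A/k,q}` on points (`(∀ a ∈ 𝔭, ι(a) t = 1) → t ≫ F = 1`) and `ψ_P`, `F`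
have the same constant rank `d`, then there is an isomorphism `e : A ⊗_𝒪 𝔟 ≅ A^{(q)}` over `k` with `ψ_P ≫ e = F`; it is a homomorphism, `𝒪`-equivariant
for the Serre action and `ι^{(q)}`, and the unique factorisation (★ ST-2 with `φ := F`, §1). [cite: Shimura1998, §13.1 proof of Thm. 1 (pp. 97–99)]
[cite: MilneCM2006, §7 (Prop. 7.22, Rem. 7.23)] [cite: MumfordAV1970, §7 Thm. 4 (p. 72)] -/
theorem exists_iso_serreTranslate_comp_eq_relFrobenius (hN : N ≠ 0) (hP : E' * P = P) (hQ : Q * E' = Q)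
    (hQP : Q * P = Matrix.scalar (Fin 1) (N : O)) (hPQ : P * Q = Matrix.scalar (Fin m) (N : O) * E')
    {𝔭 : Ideal O} (h𝔭 : Ideal.span (Set.range fun k => P k 0) = 𝔭)
    (hker : ∀ ⦃T : Over (Spec (.of k))⦄ (t : T ⟶ (AbelianScheme.ofAbelianVariety A).toOver.X),
      (∀ a ∈ 𝔭, t ≫ act.i a = 1) → t ≫ relFrobeniusHom p n A = 1)
    (d : ℕ) (hdψ : ∀ c : (serreTensor act E' hE').left, (serreTranslate act E' hE' P).left.finrank c = d)
    (hdF : ∀ b : (AbelianScheme.ofAbelianVariety (A.frobeniusTwist p n)).toOver.left, (relFrobeniusHom p n A).left.finrank b = d) :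
    ∃ e : (serreTensor act E' hE').X ≅ (AbelianScheme.ofAbelianVariety (A.frobeniusTwist p n)).toOver.X,
      serreTranslate act E' hE' P ≫ e.hom = relFrobeniusHom p n A ∧ IsMonHom e.hom ∧
        (∀ a, (serreAction act E' hE').i a ≫ e.hom = e.hom ≫ (act.frobeniusTwist p n).i a) ∧
          ∀ χ : (serreTensor act E' hE').X ⟶ (AbelianScheme.ofAbelianVariety (A.frobeniusTwist p n)).toOver.X,
            serreTranslate act E' hE' P ≫ χ = relFrobeniusHom p n A → χ = e.hom := by
  haveI := isMonHom_relFrobeniusHom p n A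
  haveI := isFinite_relFrobeniusHom_left p n A
  haveI := flat_relFrobeniusHom_left p n A
  exact exists_iso_serreTranslate_comp_eq_of_forall_comp_eq_one act E' hE' P Q (act.frobeniusTwist p n)
    (relFrobeniusHom p n A) hN hP hQ hQP hPQ h𝔭 (RingAction.i_comp_relFrobeniusHom p n act) hker d hdψ hdF

/-- (R1) over a PERFECT field, with the rank of `F` discharged (`d = q^{dim A}`, §1): `A[𝔭] ⊆ Ker F` and `rk ψ_P ≡ q^{dim A}` ⇒ `A ⊗_𝒪 𝔟 ≅ A^{(q)}` under `A`.
[cite: Shimura1998, §13.1 proof of Thm. 1 (pp. 97–99)] [cite: MilneCM2006, §7 (Prop. 7.22, Rem. 7.23)] -/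
theorem exists_iso_serreTranslate_comp_eq_relFrobenius_of_perfectField [PerfectField k] (hN : N ≠ 0) (hP : E' * P = P)
    (hQ : Q * E' = Q) (hQP : Q * P = Matrix.scalar (Fin 1) (N : O)) (hPQ : P * Q = Matrix.scalar (Fin m) (N : O) * E')
    {𝔭 : Ideal O} (h𝔭 : Ideal.span (Set.range fun k => P k 0) = 𝔭)
    (hker : ∀ ⦃T : Over (Spec (.of k))⦄ (t : T ⟶ (AbelianScheme.ofAbelianVariety A).toOver.X),
      (∀ a ∈ 𝔭, t ≫ act.i a = 1) → t ≫ relFrobeniusHom p n A = 1)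
    (hdψ : ∀ c : (serreTensor act E' hE').left, (serreTranslate act E' hE' P).left.finrank c = p ^ (n * A.dim)) :
    ∃ e : (serreTensor act E' hE').X ≅ (AbelianScheme.ofAbelianVariety (A.frobeniusTwist p n)).toOver.X,
      serreTranslate act E' hE' P ≫ e.hom = relFrobeniusHom p n A ∧ IsMonHom e.hom ∧
        (∀ a, (serreAction act E' hE').i a ≫ e.hom = e.hom ≫ (act.frobeniusTwist p n).i a) ∧
          ∀ χ : (serreTensor act E' hE').X ⟶ (AbelianScheme.ofAbelianVariety (A.frobeniusTwist p n)).toOver.X,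
            serreTranslate act E' hE' P ≫ χ = relFrobeniusHom p n A → χ = e.hom :=
  exists_iso_serreTranslate_comp_eq_relFrobenius p n act E' hE' P Q hN hP hQ hQP hPQ h𝔭 hker (p ^ (n * A.dim)) hdψ
    (finrank_relFrobeniusHom_left p n A)

/-- (R1) … and then **`Ker F = A[𝔭]` exactly**: `t ≫ F = 1 ↔ ∀ a ∈ 𝔭, ι(a) t = 1`, for any isomorphism `e` (a homomorphism) with `ψ_P ≫ e = F`
(★ `comp_eq_one_iff_forall_mem_of_serreTranslate_comp_eq`). [cite: MumfordAV1970, §7 Thm. 4 (p. 72)] [cite: MilneCM2006, §7 (Prop. 7.22, Rem. 7.23)] -/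
theorem comp_relFrobenius_eq_one_iff_forall_mem_of_serreTranslate_comp_eq (hP : E' * P = P) {𝔭 : Ideal O}
    (h𝔭 : Ideal.span (Set.range fun k => P k 0) = 𝔭)
    (e : (serreTensor act E' hE').X ≅ (AbelianScheme.ofAbelianVariety (A.frobeniusTwist p n)).toOver.X) [IsMonHom e.hom]
    (he : serreTranslate act E' hE' P ≫ e.hom = relFrobeniusHom p n A)
    {T : Over (Spec (.of k))} (t : T ⟶ (AbelianScheme.ofAbelianVariety A).toOver.X) :
    t ≫ relFrobeniusHom p n A = 1 ↔ ∀ a ∈ 𝔭, t ≫ act.i a = 1 :=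
  comp_eq_one_iff_forall_mem_of_serreTranslate_comp_eq act E' hE' P
    (B := (AbelianScheme.ofAbelianVariety (A.frobeniusTwist p n)).toOver) (relFrobeniusHom p n A) hP h𝔭 e he t

/-! ## §3 (R2) `Ker F ⊆ A[𝔭]` and equal ranks ⇒ `A^{(q)} ≅ A ⊗_𝒪 𝔟` under `A`, `F ↦ ψ_P` -/

/-- **(R2) THE FROBENIUS TWIST IS THE SERRE TENSOR, `F ↦ ψ_P`.**  If `Ker F_{A/k,q} ⊆ A[𝔭]` on points (`t ≫ F = 1 → ∀ a ∈ 𝔭, ι(a) t = 1`) and `F`, `ψ_P` have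
the same constant rank `d`, then there is an isomorphism `e : A^{(q)} ≅ A ⊗_𝒪 𝔟` over `k` with `F ≫ e = ψ_P`; it is a homomorphism, `𝒪`-equivariant for
`ι^{(q)}` and the Serre action, and the unique factorisation (★ ST-2b: descent of `ψ_P` along the fppf cover `F`, then degrees).
[cite: Shimura1998, §13.1 proof of Thm. 1 (pp. 97–99)] [cite: MumfordAV1970, §7 Thm. 4 (p. 72)] [cite: Conrad2004GrossZagier, §7 (Thm. 7.5)] -/
theorem exists_iso_relFrobenius_comp_eq_serreTranslate (hN : N ≠ 0) (hP : E' * P = P) (hQ : Q * E' = Q)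
    (hQP : Q * P = Matrix.scalar (Fin 1) (N : O)) (hPQ : P * Q = Matrix.scalar (Fin m) (N : O) * E')
    {𝔭 : Ideal O} (h𝔭 : Ideal.span (Set.range fun k => P k 0) = 𝔭)
    (hker : ∀ ⦃T : Over (Spec (.of k))⦄ (t : T ⟶ (AbelianScheme.ofAbelianVariety A).toOver.X),
      t ≫ relFrobeniusHom p n A = 1 → ∀ a ∈ 𝔭, t ≫ act.i a = 1)
    (d : ℕ) (hdF : ∀ b : (AbelianScheme.ofAbelianVariety (A.frobeniusTwist p n)).toOver.left, (relFrobeniusHom p n A).left.finrank b = d)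
    (hdψ : ∀ c : (serreTensor act E' hE').left, (serreTranslate act E' hE' P).left.finrank c = d) :
    ∃ e : (AbelianScheme.ofAbelianVariety (A.frobeniusTwist p n)).toOver.X ≅ (serreTensor act E' hE').X,
      relFrobeniusHom p n A ≫ e.hom = serreTranslate act E' hE' P ∧ IsMonHom e.hom ∧
        (∀ a, (act.frobeniusTwist p n).i a ≫ e.hom = e.hom ≫ (serreAction act E' hE').i a) ∧
          ∀ χ : (AbelianScheme.ofAbelianVariety (A.frobeniusTwist p n)).toOver.X ⟶ (serreTensor act E' hE').X,
            relFrobeniusHom p n A ≫ χ = serreTranslate act E' hE' P → χ = e.hom := by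
  haveI := isMonHom_relFrobeniusHom p n A
  haveI := isFinite_relFrobeniusHom_left p n A
  haveI := flat_relFrobeniusHom_left p n A
  haveI := surjective_relFrobeniusHom_left p n A
  haveI := isMonHom_serreTranslate act E' hE' P
  haveI := isFinite_serreTranslate_left act E' hE' P Q hN hP hQ hQP hPQ
  haveI := flat_serreTranslate_left act E' hE' P Q hN hP hQ hQP hPQ
  exact exists_iso_comp_eq_equivariant_of_forall_comp_eq_one (C := (AbelianScheme.ofAbelianVariety (A.frobeniusTwist p n)).toOver)
    (relFrobeniusHom p n A) act (serreAction act E' hE') (act.frobeniusTwist p n) (serreTranslate act E' hE' P)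
    (RingAction.i_comp_relFrobeniusHom p n act) (i_comp_serreTranslate act E' hE' P hP)
    (fun T t ht => comp_serreTranslate_eq_one_of_forall_mem act E' hE' P hP h𝔭 t (hker t ht)) d hdF hdψ

/-- (R2) over a PERFECT field, with the rank of `F` discharged (`d = q^{dim A}`, §1). [cite: Shimura1998, §13.1 proof of Thm. 1 (pp. 97–99)]
[cite: MumfordAV1970, §7 Thm. 4 (p. 72)] -/
theorem exists_iso_relFrobenius_comp_eq_serreTranslate_of_perfectField [PerfectField k] (hN : N ≠ 0) (hP : E' * P = P)
    (hQ : Q * E' = Q) (hQP : Q * P = Matrix.scalar (Fin 1) (N : O)) (hPQ : P * Q = Matrix.scalar (Fin m) (N : O) * E')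
    {𝔭 : Ideal O} (h𝔭 : Ideal.span (Set.range fun k => P k 0) = 𝔭)
    (hker : ∀ ⦃T : Over (Spec (.of k))⦄ (t : T ⟶ (AbelianScheme.ofAbelianVariety A).toOver.X),
      t ≫ relFrobeniusHom p n A = 1 → ∀ a ∈ 𝔭, t ≫ act.i a = 1)
    (hdψ : ∀ c : (serreTensor act E' hE').left, (serreTranslate act E' hE' P).left.finrank c = p ^ (n * A.dim)) :
    ∃ e : (AbelianScheme.ofAbelianVariety (A.frobeniusTwist p n)).toOver.X ≅ (serreTensor act E' hE').X,
      relFrobeniusHom p n A ≫ e.hom = serreTranslate act E' hE' P ∧ IsMonHom e.hom ∧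
        (∀ a, (act.frobeniusTwist p n).i a ≫ e.hom = e.hom ≫ (serreAction act E' hE').i a) ∧
          ∀ χ : (AbelianScheme.ofAbelianVariety (A.frobeniusTwist p n)).toOver.X ⟶ (serreTensor act E' hE').X,
            relFrobeniusHom p n A ≫ χ = serreTranslate act E' hE' P → χ = e.hom :=
  exists_iso_relFrobenius_comp_eq_serreTranslate p n act E' hE' P Q hN hP hQ hQP hPQ h𝔭 hker (p ^ (n * A.dim))
    (finrank_relFrobeniusHom_left p n A) hdψ

/-- (R2) … and then **`Ker F = A[𝔭]` exactly**, for any isomorphism `e` (a homomorphism) with `F ≫ e = ψ_P` (★ `comp_eq_one_iff_of_iso_comp_eq`,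
★ `comp_serreTranslate_eq_one_iff_forall_mem`). [cite: MumfordAV1970, §7 Thm. 4 (p. 72)] [cite: MilneCM2006, §7 (Prop. 7.22, Rem. 7.23)] -/
theorem comp_relFrobenius_eq_one_iff_forall_mem_of_relFrobenius_comp_eq (hP : E' * P = P) {𝔭 : Ideal O}
    (h𝔭 : Ideal.span (Set.range fun k => P k 0) = 𝔭)
    (e : (AbelianScheme.ofAbelianVariety (A.frobeniusTwist p n)).toOver.X ≅ (serreTensor act E' hE').X) [IsMonHom e.hom]
    (he : relFrobeniusHom p n A ≫ e.hom = serreTranslate act E' hE' P)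
    {T : Over (Spec (.of k))} (t : T ⟶ (AbelianScheme.ofAbelianVariety A).toOver.X) :
    t ≫ relFrobeniusHom p n A = 1 ↔ ∀ a ∈ 𝔭, t ≫ act.i a = 1 := by
  rw [← comp_serreTranslate_eq_one_iff_forall_mem act E' hE' P hP h𝔭 t]
  exact comp_eq_one_iff_of_iso_comp_eq (AbelianScheme.ofAbelianVariety A).toOver
    (C := (AbelianScheme.ofAbelianVariety (A.frobeniusTwist p n)).toOver) (relFrobeniusHom p n A)
    (serreTranslate act E' hE' P) e he t

end AbelianSchemeOver

end Literature.AlgebraicGeometry.AbelianSchemes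

end
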